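import Summits.BirchSwinnertonDyer.BirchSwinnertonDyer.Theorems.SignedLowerHalvesKobayashiMainConjectureSmallImageTeichOrbitMu
import HarnessLib

/-!
# Route `SignedLowerHalves`, crux 3 `KobayashiLowerHalfLargeImage` (item stmt-BirchSwinnertonDyer-19001):
# line `horocycle_mu_floor` — its certificate `HoroNonvanishing f p` («some Mazur–Tate element `θ_n(f)` has a
# coefficient of non-positive `p`-adic valuation») HOLDS UNCONDITIONALLY at `p = 3` for the newform of every
# curve with good reduction at `3` and `a₃ = 0`; hence the sketch's `ReductionAtThree` holds with its (Conn)
# hypothesis DROPPED (cell `bsd-ssimc`, width seat `bsd-line-slh-p1-w2` gen 5, file 3; helper `--supports 19001`)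

HONEST FRAMING: the crux is OPEN and nothing here proves it; BSD is not proved by any of this. THEOREMS ONLY
(no `def`, no named fact, no `sorry`). SUPPORT for the UNREGISTERED line `Lines/horocycle_mu_floor.lean` (k2 g16),
continuing this seat's `…Theorems.HorocycleMuDoor` (p647721) / `…HorocycleMuFloor` and w6's `…LargeImageMuFloor`.

* §1 (pure algebra) `norm_coeff_comp_X_sub_one_le`: the coefficients of `P ∘ (X − 1)` are `ℤ`-combinations of the
  coefficients of `P ∈ ℚ[X]`, so their `p`-adic norms are bounded by the largest coefficient norm of `P`
  (ultrametric); hence (`exists_one_le_norm_coeff_of_norm_coeff_comp_eq_one`) a UNIT group-ring coefficient of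
  `θ_n` (coefficient of `(1+T)ˢ`, i.e. of `Tˢ` in `θ_n ∘ (T − 1)` — the ω⁰ Teichmüller-orbit sum, tree
  `coeff_comp_mazurTateElement`) forces a monomial coefficient of `θ_n` of norm `≥ 1`:
  `horoNonvanishing_of_norm_coeff_comp_mazurTateElement_eq_one`.
* §2 **`p = 3`, INPUT-FREE**: `horoNonvanishing_three_of_isNewformOf` — for `W/ℚ` globally minimal with good
  reduction at `3`, `a₃ = 0`, and its newform `f`: `∃ n k, [T^k]θ_n(f) ≠ 0 ∧ ord₃ [T^k]θ_n(f) ≤ 0`. Inputs, all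
  tree THEOREMS: slh-p3's `exists_unit_norm_ratPlusSymbol_three_eq_one_of_isNewformOf` (a unit plus symbol
  `[u/3^{n+1}]⁺_f`: THEOREM B road on Vaserstein's theorem + Serre Prop. 12), `exists_eq_pow_four_or_neg`
  (`u = ±4ˢ`), `coeff_comp_mazurTateElement_three` (the orbit sum at `3` is `2[4ˢ/3^{n+1}]⁺`), §1. So the sketch's
  `ReductionAtThree` holds with its (Conn) hypothesis UNUSED: `reductionAtThree_unconditional` (its body with the
  `HorocycleGeneration` binder dropped — a STRONGER statement; the sketch's form is a weakening).
* §3 odd `p`: `horoNonvanishing_of_teichOrbitNonConstantAt` (⟸ the carrier `TeichOrbitNonConstantAt W p`) and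
  `horoNonvanishing_of_teichSpanGenAll` (`p ≥ 5`, ⟸ Conjecture B⁰ `TeichSpanGenAll`, OPEN, displayed).

With p647721 (`descentStabilisation_holds`: `HoroNonvanishing f p` ⟹ one sign with `μ(L^ε_p) = 0`) this is a
second, certificate-level road to w6's `signedMuFloor_three'`; its own content is the EXISTENCE of a per-pair
Mazur–Tate certificate at `3` for every such curve. CALIBRATION / SUPPORT ONLY.

References: [Pollack2003] Def. 6.15, Rem. 6.16, Prop. 6.18; [MazurTateTeitelbaum1986Invent] §I.10 (10.1);
[Vaserstein1972SL2] Theorem; [Serre1972] §1.11 Prop. 12; [Manin1972] Prop. 1.4 (B⁰'s vocabulary).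
-/

set_option autoImplicit false
set_option linter.dupNamespace false

noncomputable section

open scoped Classical MatrixGroups ModularForm

open Polynomial CongruenceSubgroup WeierstrassCurve Literature.NumberTheory.EllipticCurves
  Literature.NumberTheory.EllipticCurves.ModularForms
  Literature.NumberTheory.EllipticCurves.Rank1Residual
  Literature.NumberTheory.EllipticCurves.Rank1Residual.Typed
  Summit.BirchSwinnertonDyer.BirchSwinnertonDyer.Theorems.SmallImageCycWindingMuThree
  Summit.BirchSwinnertonDyer.BirchSwinnertonDyer.Theorems.SmallImageOrbitSumMuThree
  Summit.BirchSwinnertonDyer.BirchSwinnertonDyer.Theorems.SmallImageTeichOrbitMu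
  Summit.BirchSwinnertonDyer.BirchSwinnertonDyer.Cruxes.AnalyticMuZeroX9.TeichSpan

namespace Summit.BirchSwinnertonDyer.BirchSwinnertonDyer.Theorems.HorocycleMuDoor

/-! ## §1. Group-ring coefficients vs. monomial coefficients (ultrametric bookkeeping) -/

section Comp

variable {p : ℕ} [hp : Fact p.Prime]

/-- **The coefficients of `P ∘ (X − 1)` are `ℤ`-combinations of those of `P`**: if every coefficient of `P ∈ ℚ[X]`
has `p`-adic norm `≤ C`, so does every coefficient of `P.comp (X − 1)` (`(X − 1)^e` has integer coefficients;
ultrametric inequality for finite sums). [folklore] -/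
theorem norm_coeff_comp_X_sub_one_le (P : ℚ[X]) {C : ℝ} (hC : 0 ≤ C)
    (h : ∀ k : ℕ, ‖((P.coeff k : ℚ) : ℚ_[p])‖ ≤ C) (s : ℕ) :
    ‖(((P.comp (X - 1)).coeff s : ℚ) : ℚ_[p])‖ ≤ C := by
  rw [Polynomial.comp_eq_sum_left, Polynomial.sum_def, Polynomial.finsetSum_coeff]
  push_cast
  refine IsUltrametricDist.norm_sum_le_of_forall_le_of_nonneg hC fun e _ ↦ ?_
  have hint : ((X - 1 : ℚ[X]) ^ e).coeff s = (((((X : ℤ[X]) - 1) ^ e).coeff s : ℤ) : ℚ) := by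
    have hmap : ((X - 1 : ℚ[X]) ^ e) = (((X : ℤ[X]) - 1) ^ e).map (Int.castRingHom ℚ) := by
      rw [Polynomial.map_pow, Polynomial.map_sub, Polynomial.map_X, Polynomial.map_one]
    rw [hmap, Polynomial.coeff_map, eq_intCast]
  rw [Polynomial.coeff_C_mul, hint]
  push_cast
  rw [norm_mul]
  have hz : ‖(((((X : ℤ[X]) - 1) ^ e).coeff s : ℤ) : ℚ_[p])‖ ≤ 1 := Padic.norm_int_le_one _
  calc ‖((P.coeff e : ℚ) : ℚ_[p])‖ * ‖(((((X : ℤ[X]) - 1) ^ e).coeff s : ℤ) : ℚ_[p])‖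
      ≤ C * 1 := mul_le_mul (h e) hz (norm_nonneg _) hC
    _ = C := mul_one C

/-- **A UNIT coefficient of `P ∘ (X − 1)` forces a coefficient of `P` of norm `≥ 1`** (contrapositive of §1 with
`C` = the largest coefficient norm of `P`, which is `< 1` if all are). [folklore] -/
theorem exists_one_le_norm_coeff_of_norm_coeff_comp_eq_one (P : ℚ[X]) {s : ℕ}
    (hs : ‖(((P.comp (X - 1)).coeff s : ℚ) : ℚ_[p])‖ = 1) :
    ∃ k : ℕ, 1 ≤ ‖((P.coeff k : ℚ) : ℚ_[p])‖ := by
  by_contra hcon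
  push Not at hcon
  rcases P.support.eq_empty_or_nonempty with hemp | hne
  · have hP : P = 0 := Polynomial.support_eq_empty.mp hemp
    rw [hP, Polynomial.zero_comp, Polynomial.coeff_zero, Rat.cast_zero, norm_zero] at hs
    exact zero_ne_one hs
  · obtain ⟨k₀, -, hmax⟩ := Finset.exists_max_image P.support (fun k ↦ ‖((P.coeff k : ℚ) : ℚ_[p])‖) hne
    have hle : ∀ k : ℕ, ‖((P.coeff k : ℚ) : ℚ_[p])‖ ≤ ‖((P.coeff k₀ : ℚ) : ℚ_[p])‖ := by
      intro k
      by_cases hk : k ∈ P.support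
      · exact hmax k hk
      · rw [Polynomial.notMem_support_iff.mp hk, Rat.cast_zero, norm_zero]
        exact norm_nonneg _
    have h := norm_coeff_comp_X_sub_one_le P (norm_nonneg _) hle s
    rw [hs] at h
    exact absurd (lt_of_le_of_lt h (hcon k₀)) (lt_irrefl _)

/-- **A unit group-ring coefficient of `θ_n` gives the sketch's `HoroNonvanishing` at level `n`**: if the coefficient
of `Tˢ` in `θ_n(f) ∘ (T − 1)` (= of `(1+T)ˢ` in `θ_n`, = the ω⁰ Teichmüller-orbit sum `Σ_η [ηγˢ/p^{n+1}]⁺_f`, tree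
`coeff_comp_mazurTateElement`) is a `p`-adic unit, then some monomial coefficient `[T^k]θ_n(f)` is non-zero of
valuation `≤ 0`. [cite: Pollack2003, Def. 6.15 and Remark 6.16] -/
theorem horoNonvanishing_of_norm_coeff_comp_mazurTateElement_eq_one {N : ℕ} {f : CuspForm (Gamma0 N) 2} {n s : ℕ}
    (hs : ‖((((mazurTateElement f p n).comp (X - 1)).coeff s : ℚ) : ℚ_[p])‖ = 1) :
    ∃ k : ℕ, (mazurTateElement f p n).coeff k ≠ 0 ∧ padicValRat p ((mazurTateElement f p n).coeff k) ≤ 0 := by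
  obtain ⟨k, hk⟩ := exists_one_le_norm_coeff_of_norm_coeff_comp_eq_one (mazurTateElement f p n) hs
  have hp1 : (1 : ℝ) < p := by exact_mod_cast hp.out.one_lt
  have hk0 : (mazurTateElement f p n).coeff k ≠ 0 := by
    intro h0
    rw [h0, Rat.cast_zero, norm_zero] at hk
    exact absurd hk (by norm_num)
  refine ⟨k, hk0, ?_⟩
  have hne : (((mazurTateElement f p n).coeff k : ℚ) : ℚ_[p]) ≠ 0 := by exact_mod_cast hk0
  rw [Padic.norm_eq_zpow_neg_valuation hne, Padic.valuation_ratCast, one_le_zpow_iff_right₀ hp1] at hk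
  linarith

end Comp

/-! ## §2. `p = 3`: `HoroNonvanishing` for the newform of every curve good at `3` with `a₃ = 0` — INPUT-FREE -/

section Three

variable {N : ℕ} [NeZero N] (f : CuspForm (Gamma0 N) 2)

/-- **`HoroNonvanishing f 3`, unconditionally**: for `W/ℚ` globally minimal with good reduction at `3` and `a₃ = 0`
and its newform `f` (any level), some Mazur–Tate element `θ_n(f)` at `3` has a coefficient `[T^k]θ_n ≠ 0` with
`ord₃ ≤ 0`. Proof: a unit plus symbol `[u/3^{n+1}]⁺_f` (THEOREM B road, `exists_unit_norm_ratPlusSymbol_three_eq_one_of_isNewformOf`),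
`u = ±4ˢ` (`exists_eq_pow_four_or_neg`), evenness of `[·]⁺`, the `p = 3` orbit sum `coeff_s(θ_n ∘ (T−1)) = 2[4ˢ/3^{n+1}]⁺`
(`coeff_comp_mazurTateElement_three`), and §1. [cite: Vaserstein1972SL2, Theorem] [cite: Serre1972, §1.11 Prop. 12]
[cite: Pollack2003, Def. 6.15 and Remark 6.16] [cite: MazurTateTeitelbaum1986Invent, §I.10 (10.1)] -/
theorem horoNonvanishing_three_of_isNewformOf {W : WeierstrassCurve ℚ} [W.IsElliptic] [W.IsGloballyMinimal]
    (hf : IsNewformOf W f) (hgood : W.HasGoodReductionAtPrime 3) (hap : W.frobeniusTrace 3 = 0) :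
    ∃ n k : ℕ, (mazurTateElement f 3 n).coeff k ≠ 0 ∧ padicValRat 3 ((mazurTateElement f 3 n).coeff k) ≤ 0 := by
  obtain ⟨n, u, hunit⟩ := exists_unit_norm_ratPlusSymbol_three_eq_one_of_isNewformOf f hf hgood hap
  haveI hN : NeZero (3 ^ (n + 1)) := ⟨pow_ne_zero _ (by decide)⟩
  haveI : Nontrivial (ZMod (3 ^ (n + 1))) := ZMod.nontrivial_iff.mpr (by
    have := Nat.one_lt_pow (n := n + 1) (by omega) (show 1 < 3 by decide); omega)
  obtain ⟨s, hs, hu⟩ := exists_eq_pow_four_or_neg n u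
  -- the symbol at `u` equals the symbol at `4^s`
  have hsym : ratPlusSymbol f (((u : ZMod (3 ^ (n + 1))).val : ℚ) / (3 : ℚ) ^ (n + 1)) =
      ratPlusSymbol f ((((4 : ZMod (3 ^ (n + 1))) ^ s).val : ℚ) / (3 : ℚ) ^ (n + 1)) := by
    rcases hu with hu | hu
    · rw [hu]
    · rw [hu]
      refine ratPlusSymbol_neg_val_three f n ?_
      intro h0
      apply u.ne_zero
      rw [hu, h0, neg_zero]
  -- the group-ring coefficient `2[4^s/3^{n+1}]⁺` is a `3`-adic unit
  have h2 : ‖((2 : ℚ) : ℚ_[3])‖ = 1 := by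
    rw [show ((2 : ℚ) : ℚ_[3]) = ((2 : ℕ) : ℚ_[3]) by norm_cast, Padic.norm_natCast_eq_one_iff]
    decide
  have hcoeff : ‖((((mazurTateElement f 3 n).comp (X - 1)).coeff s : ℚ) : ℚ_[3])‖ = 1 := by
    rw [coeff_comp_mazurTateElement_three f n s hs, ← hsym]
    push_cast
    rw [norm_mul, show ((2 : ℚ_[3])) = ((2 : ℚ) : ℚ_[3]) by norm_cast, h2, one_mul]
    exact_mod_cast hunit
  exact ⟨n, horoNonvanishing_of_norm_coeff_comp_mazurTateElement_eq_one hcoeff⟩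

/-- **The sketch's `ReductionAtThree`, with its (Conn) hypothesis DROPPED** (a stronger statement; the sketch's
form `… → (¬ p ∣ N → HorocycleGeneration N p) → HoroNonvanishing f p` is this one weakened by an unused binder):
at `p = 3`, for `W` in class X7 with `a₃ = 0` (the binders `Surj W p` and non-semistability are idle) and its newform
`f` of level `N_W`, `HoroNonvanishing f p`. [cite: Vaserstein1972SL2, Theorem] [cite: Pollack2003, Def. 6.15 and Remark 6.16] -/
theorem reductionAtThree_unconditional :
    ∀ (W : WeierstrassCurve ℚ) [W.IsElliptic] [W.IsGloballyMinimal] (p : ℕ) [Fact p.Prime]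
      [NeZero (W.conductorNorm ℤ)] (f : CuspForm (Gamma0 (W.conductorNorm ℤ)) 2),
      p = 3 → IsNewformOf W f → ClassX7 W p → W.frobeniusTrace p = 0 → Surj W p →
      ∃ n k : ℕ, (mazurTateElement f p n).coeff k ≠ 0 ∧ padicValRat p ((mazurTateElement f p n).coeff k) ≤ 0 := by
  intro W _ _ p _ _ f hp3 hf hX hap _
  subst hp3
  exact horoNonvanishing_three_of_isNewformOf f hf hX.1.1 hap

end Three

/-! ## §3. Odd `p`: `HoroNonvanishing` from the Teichmüller-orbit carrier, and at `p ≥ 5` from Conjecture B⁰ -/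

section Odd

variable {N : ℕ} [NeZero N] (f : CuspForm (Gamma0 N) 2) {p : ℕ} [hp : Fact p.Prime]

/-- **`HoroNonvanishing f p` ⟸ `TeichOrbitNonConstantAt W p`** at an odd good prime with `a_p = 0`: two orbit sums
differing by a unit make one orbit sum `S_f(p, n+1, b)` a unit (ultrametric + integrality `norm_teichOrbitSum_le_one`);
`b = η̄₀γˢ` (`exists_coe_eq_toZModPow_mul_pow`); the orbit sum IS the group-ring coefficient `coeff_s(θ_n ∘ (T−1))`
(`teichOrbitSum_eq_coeff_comp_mazurTateElement`); §1. [cite: MazurTateTeitelbaum1986Invent, §I.10 (10.1)]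
[cite: Pollack2003, Def. 6.15 and Remark 6.16] -/
theorem horoNonvanishing_of_teichOrbitNonConstantAt {W : WeierstrassCurve ℚ} [W.IsElliptic] [W.IsGloballyMinimal]
    (hp2 : p ≠ 2) (hf : IsNewformOf W f) (hgood : W.HasGoodReductionAtPrime p) (hap : W.frobeniusTrace p = 0)
    (hT : TeichOrbitNonConstantAt W p) :
    ∃ n k : ℕ, (mazurTateElement f p n).coeff k ≠ 0 ∧ padicValRat p ((mazurTateElement f p n).coeff k) ≤ 0 := by
  have hpP : p.Prime := Fact.out
  have hpN : ¬ p ∣ N := not_dvd_level_of_isNewformOf hf hgood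
  have hap' : cuspCoeff f p = ((0 : ℤ) : ℂ) := by
    rw [cuspCoeff_eq_frobeniusTrace_of_isNewformOf_holds hf hgood, hap]
  obtain ⟨m, hm, a, a', h1⟩ := hT f hf
  -- one of the two orbit sums is a `p`-adic unit
  have hone : ∃ b : (ZMod (p ^ m))ˣ, ‖((teichOrbitSum f p m (b : ZMod (p ^ m)) : ℚ) : ℚ_[p])‖ = 1 := by
    have hmax : 1 ≤ max ‖((teichOrbitSum f p m (a : ZMod (p ^ m)) : ℚ) : ℚ_[p])‖
        ‖((teichOrbitSum f p m (a' : ZMod (p ^ m)) : ℚ) : ℚ_[p])‖ := by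
      refine le_trans h1 ?_
      push_cast
      rw [sub_eq_add_neg]
      refine le_trans (IsUltrametricDist.norm_add_le_max _ _) ?_
      rw [norm_neg]
    rcases le_max_iff.mp hmax with ha | ha'
    · exact ⟨a, le_antisymm (norm_teichOrbitSum_le_one f hp2 hf.1 hpN hap' m _) ha⟩
    · exact ⟨a', le_antisymm (norm_teichOrbitSum_le_one f hp2 hf.1 hpN hap' m _) ha'⟩
  obtain ⟨b, hb1⟩ := hone
  obtain ⟨n, rfl⟩ : ∃ n, m = n + 1 := ⟨m - 1, by omega⟩
  obtain ⟨ξ₀, s, hb⟩ := exists_coe_eq_toZModPow_mul_pow hp2 n b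
  have hs : s.val < p ^ n := by
    haveI : NeZero (p ^ n) := ⟨pow_ne_zero _ hpP.ne_zero⟩
    exact ZMod.val_lt s
  rw [teichOrbitSum_eq_coeff_comp_mazurTateElement f hp2 n ξ₀ hs (b : ZMod (p ^ (n + 1))) hb] at hb1
  exact ⟨n, horoNonvanishing_of_norm_coeff_comp_mazurTateElement_eq_one hb1⟩

/-- **`p ≥ 5`: `HoroNonvanishing f p` ⟸ Conjecture B⁰** (`TeichSpanGenAll`, cell bsd-f3-mu; OPEN, a displayed
hypothesis): B⁰ ⟹ `TeichOrbitNonConstantAt W p` given `E[p]` irreducible (Serre Prop. 12 at a supersingular prime)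
and winding non-constancy (THEOREM B road, input-free); then `horoNonvanishing_of_teichOrbitNonConstantAt`.
[cite: Manin1972, Prop. 1.4] [cite: Serre1972, §1.11 Prop. 12] [cite: MazurTateTeitelbaum1986Invent, §I.10 (10.1)] -/
theorem horoNonvanishing_of_teichSpanGenAll (hB : TeichSpanGenAll) {W : WeierstrassCurve ℚ} [W.IsElliptic]
    [W.IsGloballyMinimal] (hp5 : 5 ≤ p) (hf : IsNewformOf W f) (hgood : W.HasGoodReductionAtPrime p)
    (hap : W.frobeniusTrace p = 0) :
    ∃ n k : ℕ, (mazurTateElement f p n).coeff k ≠ 0 ∧ padicValRat p ((mazurTateElement f p n).coeff k) ≤ 0 := by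
  have hp2 : p ≠ 2 := by omega
  have hirr : W.HasIrreducibleModPGaloisRep p :=
    hasIrreducibleModPGaloisRep_of_dvd_frobeniusTrace W p hp2
      (W.not_dvd_minimalDiscriminantInt_of_hasGoodReductionAtPrime' p hgood) (by rw [hap]; exact dvd_zero _)
  have hcyc : CycWindingNonConstantAt W p :=
    Summit.BirchSwinnertonDyer.BirchSwinnertonDyer.Rank1Residual.EvenBranch.cycWindingNonConstantAt_of_odd W p hp2 hgood hirr
  exact horoNonvanishing_of_teichOrbitNonConstantAt f hp2 hf hgood hap
    (teichOrbitNonConstantAt_of_teichSpanGenAll hB W p hp5 hgood hirr hcyc)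

end Odd

end Summit.BirchSwinnertonDyer.BirchSwinnertonDyer.Theorems.HorocycleMuDoor

end
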